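import Literature.AlgebraicGeometry.Shioda1982.ExceptionalQuadruplesComplete
import HarnessLib

/-!
# Shioda 1982 / Meyer–Neutsch 1981: no exceptional quadruple at the level `N = 112` (kernel sweep)

Topic `Literature/AlgebraicGeometry/Shioda1982`; companion of `ExceptionalQuadruplesComplete.lean` (search `checkB`, soundness
`tabelleOneCompleteAt_of_chunks`, invariant form `exists_mem_reps_of_isExceptionalQuadruple`, statement `TabelleOneCompleteAt`; sources,
method and framing in its module docstring) and of the sweeps `ExceptionalQuadruplesSweepSixty/…/Ninety.lean` (all `2 ≤ N ≤ 90`). THEOREMS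
only (no definition, no named fact): the kernel search at the single level `N = 112 = 2⁴·7`, which carries NO row of
[MeyerNeutsch1981Fermatquadrupel, Tabelle 1] (computer-generated, "alle Fermatquadrupel für N ≤ 614 ermittelt", §2 p. 53) and a zero in
[Shioda1982PicardFermat, table p. 727]: `completeAt_oneHundredTwelve` (every sorted pair-free primitive Hodge 4-multiset mod `112` is
standard) and `not_isExceptionalQuadruple_oneHundredTwelve`. Use: the level `112` is the one level `16p`, `p` prime, at which the
classification of `PicardNumberTwoPowerPrime.lean` (`p ≥ 11`) and the sweeps `≤ 90` (`p = 2, 5`) leave the absence of exceptional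
quadruples uncertified (its non-standard indecomposable elements are the imprimitive lifts of the exceptional elements of the levels
`14`, `28`, `56`); with this file an exceptional quadruple at a level `16p` forces `p = 3` (`48`). `decide +kernel` only (no
`native_decide`), in `3` chunks of first entries to bound the memory of a single kernel evaluation. An independent plain-Python
enumeration of the same statement (cell `pub-hfermat`, `code/lit/complete_check.py 112`) agrees: `0` counterexamples, `0` exceptional
multisets, `48` standard primitive pair-free multisets.

HONEST FRAMING (cell `pub-hfermat`): explicit algebraic cycles for specific Hodge classes on Fermat/Delsarte varieties; residual open
instances listed; no claim on general Hodge. These classes are algebraic (Lefschetz (1,1)); certified here is only the emptiness of the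
exceptional list at this level.

## References
* [MeyerNeutsch1981Fermatquadrupel] W. Meyer, W. Neutsch, *Fermatquadrupel*, Math. Ann. 256 (1981) 51–62, §2 p. 53, Tabelle 1 p. 54 (no row `112`).
* [Shioda1982PicardFermat] T. Shioda, J. Fac. Sci. Univ. Tokyo IA 28 (1982) 725–734, table p. 727.
-/

namespace Literature.AlgebraicGeometry.Shioda1982

open Literature.AlgebraicGeometry.HodgeTheory

set_option maxHeartbeats 0 in
/-- **Tabelle 1 is complete at `N = 112`, where it is empty**: every sorted Hodge 4-multiset mod `112` without a pair and with
`gcd = 1` is standard. Kernel exhaustion (`checkB`), `3` chunks of first entries `a`.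
[cite: MeyerNeutsch1981Fermatquadrupel, §2 p. 53 ("alle Fermatquadrupel für N ≤ 614 ermittelt") and Tabelle 1 p. 54 (no row 112)]
[cite: Shioda1982PicardFermat, table p. 727] -/
theorem completeAt_oneHundredTwelve : TabelleOneCompleteAt 112 :=
  tabelleOneCompleteAt_of_chunks 112 [(0, 10), (10, 14), (24, 88)] (by decide +kernel) (by
    intro p hp
    simp only [List.mem_cons, List.not_mem_nil, or_false] at hp
    rcases hp with rfl | rfl | rfl <;> decide +kernel)

/-- **No exceptional quadruple ("Ausnahmequadrupel") at the level `112`** (`tabelleOne 112 = []`).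
[cite: MeyerNeutsch1981Fermatquadrupel, Tabelle 1 p. 54 (no row 112)] [cite: Shioda1982PicardFermat, table p. 727] -/
theorem not_isExceptionalQuadruple_oneHundredTwelve (s : Multiset (ZMod 112)) : ¬ IsExceptionalQuadruple 112 s := by
  intro hs
  obtain ⟨r, hr, -⟩ := exists_mem_reps_of_isExceptionalQuadruple completeAt_oneHundredTwelve hs
  simp [reps, tabelleOne] at hr

end Literature.AlgebraicGeometry.Shioda1982
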